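/-
Copyright: cell `pub-ymgap` (HUMAN RULING D-0062), Track A of `YM-PLAN.md`, DAG node N20 (= NE7b); R134 acceleration seat
`pub-ymgap-dag-n20-d` (generation 3), module 4.  Released under the licence of the surrounding project.
-/
import Summits.QuantumFields.YangMills.Theorems.BalabanUVNodesN20LCSAvgDomination
import Summits.QuantumFields.YangMills.Theorems.BalabanUVNodesN20LCSAvgDominationRegion
import Summits.QuantumFields.YangMills.Theorems.BalabanUVNodesN20LCSAtTStepOfRecord
import HarnessLib

/-!
# YM-DAG node N20 (= NE7b): «LCS-j» BY VALUE FOR BAŁABAN'S (0.4) AVERAGING — on a pinned density whose fields are `δ`-small near `Q`, the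
# exponential plaquette-energy carrier of the AVERAGED field is at most `exp(t·(C_L δ)²·#Q)` pointwise, hence the `LocCondStability`
# inequality for that piece holds with `b = t·(C_L δ)²·#Q` (print's by-value form, [Balaban1989LargeFieldII] p. 383 l. 21–28, for the averaging of record)

Track A of `YM-PLAN.md` (cell `pub-ymgap`, HUMAN RULING D-0062), node **N20** = spine estimate NE7b (`T4WeightBudget.RelWeightBound`, NOT PRINTED,
NOT PROVED).  Seat `pub-ymgap-dag-n20-d` (R134), generation 3, module 4; kernel theorems only (0 `def`, 0 `sorry`, standard axioms); COUNT-NEUTRAL.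

WHAT.  `Spine/NE7b/LocalConditionalStability.LocCondStability` asks, level by level, `∫ M·eterm ≤ e^{b}·∫ eterm` for a moment carrier `M` in the
history term's OWN state; its docstring records two admissible sizes of `b`: `O(1)·|Z|` uniformly in the coupling (the whole content — seat
`pub-ymgap-dag-n20-c`'s residual (ii), a CONDITIONAL estimate) or print's BY-VALUE size «constant with the logarithms» ([Balaban1989LargeFieldII]
p. 383 l. 21–28 `B16Ineq179.Txt383.afield_le`, Dimock III (186): `O(log g_j⁻²)·|Z|`), «either beaten by `a`».  The by-value size needs NO
integration: on the support of a pinned density the fields are small, and there the carrier is bounded BY VALUE.  For the carriers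
`M = exp(t·Σ_{p′∈Q}(1 − reTr V(∂p′)))` of the AVERAGED field `V = Ū` this is exactly what modules 1–2 of this seat give
(`N20LCSAvgDomination.dist1_plaqHol_avgFun_le_loc`: `|Ū(∂p′) − 1| ≤ C_L·δ` from `δ`-smallness near `p′`, `C_L = L² + 6((d+2)L)²`;
`B8Eq110UnitaryProof.cmp_specialUnitaryGroup`: `1 − reTr ≤ |· − 1|²`):

* §1 **`one_sub_reTr_plaqHol_avgFun_le_sq_of_box`** — if every plaquette of `boxRegion (emb p′₋) ((d+3)L+2)` is `δ`-close to `1` (`0 ≤ δ`,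
  `(((d+2)L)²/4)·δ < δ_N`), then `1 − reTr Ū(∂p′) ≤ (C_L·δ)²`; **`sum_one_sub_reTr_plaqHol_avgFun_le_card_mul`**, **`exp_plaqSum_avgFun_le_of_small`**
  — summed over `Q` and exponentiated: `exp(t·Σ_{p′∈Q}(1 − reTr Ū(∂p′))) ≤ exp(t·(C_L δ)²·#Q)` (`t ≥ 0`);
* §2 **`integral_exp_plaqSum_avgFun_mul_le_of_support`** — BY-VALUE «LCS» for ANY measure `ν` on the fine fields and any non-negative integrable
  density `f` whose support lies in `{U | δ-small on ⋃_{p′∈Q} boxRegion (emb p′₋) ρ}`: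
  `∫ exp(t·Σ_{p′∈Q}(1 − reTr Ū(∂p′)))·f dν ≤ exp(t·(C_L δ)²·#Q)·∫ f dν`; reading aid `plaqSmallOn_of_chiSmall_mul_ne_zero` (a
  `Setup.chiSmall S δ V` factor in front of a density pins `PlaqSmallOn S δ V` on its support);
* §3 AT THE RECORD (`G = SU(N)`, `d = 4`, `Node00.avOfRecord`, def-R's front factors `chiSeqOfRecord`, the T-step `tstepOfRecord`):
  **`measurable_exp_plaqSum_level`**, **`abs_exp_plaqSum_level_le`** (the carrier at any level is measurable and bounded by `exp(|t|·2·#Q)`) and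
  **`lcs_piece_tstepOfRecord_expPlaqSum_byValue`** — n20-c's `N20LCSAtTStepOfRecord.lcs_piece_tstepOfRecord_of_carrier_le_on_support` with its
  support hypothesis `hMb` DISCHARGED for these carriers from a SMALLNESS-ON-SUPPORT hypothesis (`hsupp`: wherever the pinned fine density of the
  sequence `s′` is non-zero, the level-`k` plaquettes in the boxes around `Q` are `δ`-small): the `LocCondStability` inequality for the piece of
  `s′` of the T-step of record, `∫ M·χ_{k+1}(s′)·(tstep … s′) ≤ exp(t·(C_L δ)²·#Q)·∫ χ_{k+1}(s′)·(tstep … s′)`.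

HONEST FRAMING.  By-value bookkeeping: `b = t·(C_L δ)²·#Q` is print's «constant with the logarithms» size once `δ² ∝ p₀(g_k)·g_k²` and `t ∝ β_k`
(it is NOT the coupling-uniform `O(1)·|Z|`, which is n20-c's conditional residual (ii)); `hsupp` is a HYPOTHESIS on the sequence's small-field
domains (reading the semantics of `chiSeqOfRecord` — which plaquettes it pins small, at which threshold — is def-R's ∕ the (α)-lineage's, not done
here); levels with large-field histories inside the boxes are exactly where `hsupp` fails (the (A1c) object, residual (iv)).  NE7b NOT PRINTED ∕ NOT
PROVED; (α)-instance 0∕1; N20 NOT discharged; typed 28∕28, discharged count untouched; one finite four-torus at fixed `ε` — NOT ℝ⁴, NOT infinite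
volume, NOT OS, NOT a mass gap, NOT Clay.

References: T. Bałaban, CMP 122 (1989) 355–392 [Balaban1989LargeFieldII] (p. 383 l. 21–28, (1.79)); CMP 98 (1985) 17–51 [Balaban1985Averaging]
(Prop. 1 (51) p.26); CMP 109 (1987) 249–301 [Balaban1987RG1] ((0.4) p.253).
-/

noncomputable section

open scoped BigOperators Matrix.Norms.L2Operator

namespace Summit.QuantumFields.YangMills.BalabanUVNodes.N20LCSAvgByValue

open MeasureTheory
open Literature.MathematicalPhysics.QuantumFieldTheory.Balaban1983to89
open T4Continuum T4ReflectionCone BlockAveraging ExpMeanLog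
open Summit.QuantumFields.YangMills.BalabanUVNodes.N20LCSAvgDomination (dist1_plaqHol_avgFun_le_loc)
open Summit.QuantumFields.YangMills.BalabanUVNodes.N20LCSAvgDominationRegion (boxRegion mem_boxRegion mem_boxRegion_of_corner)
open Summit.QuantumFields.YangMills.Theorems.HistoryTailWalkLocality (walkEnd_mem_box)
open Literature.MathematicalPhysics.QuantumFieldTheory.Balaban1983to89.B8Eq110UnitaryProof (cmp_specialUnitaryGroup)

/-! ## §1 The carrier of the averaged field by value on small fields -/

section ByValue

variable {n : Type*} [Fintype n] [DecidableEq n] [Nonempty n] {P : Params} {j : ℕ}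

/-- **THE AVERAGED PLAQUETTE ENERGY BY VALUE ON A SMALL BOX** (standing range; `SU(N)`): if every plaquette of
`boxRegion (emb p′₋) ((d+3)L + 2)` is `δ`-close to `1` (`0 ≤ δ`, `(((d+2)L)²/4)·δ < δ_N`), then `1 − reTr Ū(∂p′) ≤ ((L² + 6((d+2)L)²)·δ)²`.
[cite: Balaban1985Averaging, Prop. 1 (51) p.26; Balaban1987RG1, (0.4) p.253] -/
theorem one_sub_reTr_plaqHol_avgFun_le_sq_of_box (hj : j + 1 ≤ P.m + P.K) {δ : ℝ} (hδ : 0 ≤ δ)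
    (ht : ((((P.d + 2) * P.L : ℕ) : ℝ) ^ 2 / 4) * δ < deltaSU n) (U : GaugeField P j (Matrix.specialUnitaryGroup n ℂ))
    (p : Plaq P (j + 1)) (hsmall : ∀ q ∈ boxRegion (emb p.src) ((P.d + 3) * P.L + 2), dist1 (GaugeField.plaqHol U q) ≤ δ) :
    1 - reTr (GaugeField.plaqHol (avgFun (expMeanLogSU (n := n)) U) p) ≤
      (((P.L : ℝ) ^ 2 + 6 * (((P.d + 2) * P.L : ℕ) : ℝ) ^ 2) * δ) ^ 2 := by
  have hU : ∀ v : List (Letter P.d), v.length ≤ (P.d + 3) * P.L + 2 →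
      ∀ (a b : Fin P.d) (h : a < b), dist1 (GaugeField.plaqHol U ⟨walkEnd (emb p.src) v, a, b, h⟩) ≤ δ := by
    intro v hv a b h
    refine hsmall _ (mem_boxRegion_of_corner _ (fun ν => ?_) a b h)
    obtain ⟨e, he, hw⟩ := walkEnd_mem_box (emb p.src) v ν
    exact ⟨e, he.trans (by exact_mod_cast hv), hw⟩
  have hdist := dist1_plaqHol_avgFun_le_loc (n := n) hj hδ p hU ht
  exact (cmp_specialUnitaryGroup _).trans (pow_le_pow_left₀ (GaugeGroup.dist1_nonneg _) hdist 2)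

/-- **SUMMED OVER A FAMILY**: under `δ`-smallness on every box around `Q`, `Σ_{p′∈Q}(1 − reTr Ū(∂p′)) ≤ #Q·(C_L δ)²`.
[cite: Balaban1987RG1, (0.4) p.253] -/
theorem sum_one_sub_reTr_plaqHol_avgFun_le_card_mul (hj : j + 1 ≤ P.m + P.K) {δ : ℝ} (hδ : 0 ≤ δ)
    (ht : ((((P.d + 2) * P.L : ℕ) : ℝ) ^ 2 / 4) * δ < deltaSU n) (U : GaugeField P j (Matrix.specialUnitaryGroup n ℂ))
    (Q : Finset (Plaq P (j + 1)))
    (hsmall : ∀ p ∈ Q, ∀ q ∈ boxRegion (emb p.src) ((P.d + 3) * P.L + 2), dist1 (GaugeField.plaqHol U q) ≤ δ) :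
    ∑ p ∈ Q, (1 - reTr (GaugeField.plaqHol (avgFun (expMeanLogSU (n := n)) U) p)) ≤
      Q.card * (((P.L : ℝ) ^ 2 + 6 * (((P.d + 2) * P.L : ℕ) : ℝ) ^ 2) * δ) ^ 2 := by
  calc ∑ p ∈ Q, (1 - reTr (GaugeField.plaqHol (avgFun (expMeanLogSU (n := n)) U) p))
      ≤ ∑ _p ∈ Q, (((P.L : ℝ) ^ 2 + 6 * (((P.d + 2) * P.L : ℕ) : ℝ) ^ 2) * δ) ^ 2 :=
        Finset.sum_le_sum fun p hp => one_sub_reTr_plaqHol_avgFun_le_sq_of_box hj hδ ht U p (hsmall p hp)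
    _ = Q.card * (((P.L : ℝ) ^ 2 + 6 * (((P.d + 2) * P.L : ℕ) : ℝ) ^ 2) * δ) ^ 2 := by
        rw [Finset.sum_const, nsmul_eq_mul]

/-- **THE EXPONENTIAL CARRIER BY VALUE**: for `t ≥ 0`, under `δ`-smallness on every box around `Q`,
`exp(t·Σ_{p′∈Q}(1 − reTr Ū(∂p′))) ≤ exp(t·(C_L δ)²·#Q)`. [cite: Balaban1989LargeFieldII, p.383] -/
theorem exp_plaqSum_avgFun_le_of_small (hj : j + 1 ≤ P.m + P.K) {δ : ℝ} (hδ : 0 ≤ δ)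
    (ht : ((((P.d + 2) * P.L : ℕ) : ℝ) ^ 2 / 4) * δ < deltaSU n) {t : ℝ} (ht0 : 0 ≤ t)
    (U : GaugeField P j (Matrix.specialUnitaryGroup n ℂ)) (Q : Finset (Plaq P (j + 1)))
    (hsmall : ∀ p ∈ Q, ∀ q ∈ boxRegion (emb p.src) ((P.d + 3) * P.L + 2), dist1 (GaugeField.plaqHol U q) ≤ δ) :
    Real.exp (t * ∑ p ∈ Q, (1 - reTr (GaugeField.plaqHol (avgFun (expMeanLogSU (n := n)) U) p))) ≤
      Real.exp (t * ((((P.L : ℝ) ^ 2 + 6 * (((P.d + 2) * P.L : ℕ) : ℝ) ^ 2) * δ) ^ 2 * Q.card)) := by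
  refine Real.exp_le_exp.mpr (mul_le_mul_of_nonneg_left ?_ ht0)
  rw [mul_comm]
  exact sum_one_sub_reTr_plaqHol_avgFun_le_card_mul hj hδ ht U Q hsmall

end ByValue

/-! ## §2 By-value «LCS» against any pinned density supported on small fields -/

section Support

variable {n : Type*} [Fintype n] [DecidableEq n] [Nonempty n] {P : Params} {j : ℕ}

/-- **BY-VALUE «LCS» FOR THE AVERAGED FIELD'S EXPONENTIAL PLAQUETTE-ENERGY CARRIER**: for ANY measure `ν` on the level-`j` fields and any
non-negative `ν`-integrable density `f` supported where the fields are `δ`-small on the boxes around `Q` (`0 ≤ δ`, guard, `t ≥ 0`, standing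
range), `∫ exp(t·Σ_{p′∈Q}(1 − reTr Ū(∂p′)))·f dν ≤ exp(t·(C_L δ)²·#Q)·∫ f dν`. [cite: Balaban1989LargeFieldII, p.383] -/
theorem integral_exp_plaqSum_avgFun_mul_le_of_support (ν : Measure (GaugeField P j (Matrix.specialUnitaryGroup n ℂ)))
    (hj : j + 1 ≤ P.m + P.K) {δ : ℝ} (hδ : 0 ≤ δ) (ht : ((((P.d + 2) * P.L : ℕ) : ℝ) ^ 2 / 4) * δ < deltaSU n) {t : ℝ} (ht0 : 0 ≤ t)
    (Q : Finset (Plaq P (j + 1))) {f : GaugeField P j (Matrix.specialUnitaryGroup n ℂ) → ℝ} (hf0 : ∀ U, 0 ≤ f U)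
    (hfi : Integrable f ν)
    (hsupp : ∀ U, f U ≠ 0 → ∀ p ∈ Q, ∀ q ∈ boxRegion (emb p.src) ((P.d + 3) * P.L + 2), dist1 (GaugeField.plaqHol U q) ≤ δ) :
    ∫ U, Real.exp (t * ∑ p ∈ Q, (1 - reTr (GaugeField.plaqHol (avgFun (expMeanLogSU (n := n)) U) p))) * f U ∂ν ≤
      Real.exp (t * ((((P.L : ℝ) ^ 2 + 6 * (((P.d + 2) * P.L : ℕ) : ℝ) ^ 2) * δ) ^ 2 * Q.card)) * ∫ U, f U ∂ν := by
  set b : ℝ := t * ((((P.L : ℝ) ^ 2 + 6 * (((P.d + 2) * P.L : ℕ) : ℝ) ^ 2) * δ) ^ 2 * Q.card) with hb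
  rw [← integral_const_mul]
  refine integral_mono_of_nonneg (ae_of_all _ fun U => mul_nonneg (Real.exp_pos _).le (hf0 U)) (hfi.const_mul _)
    (ae_of_all _ fun U => ?_)
  by_cases hz : f U = 0
  · simp only [hz, mul_zero, le_refl]
  · exact mul_le_mul_of_nonneg_right (exp_plaqSum_avgFun_le_of_small hj hδ ht ht0 U Q (hsupp U hz)) (hf0 U)

/-- READING AID FOR `hsupp`: a density with a small-field factor `χ({|V(∂q) − 1| < δ, q ∈ S})` of `Setup` (`chiSmall S δ V`) in front vanishes
off `PlaqSmallOn S δ V` — so «density ≠ 0» gives `δ`-smallness on `S`. [cite: Balaban1988Convergent, (1.4) p.246] -/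
theorem plaqSmallOn_of_chiSmall_mul_ne_zero {G : Type*} [GaugeGroup G] {i : ℕ} (S : Set (Plaq P i)) (δ : ℝ) (V : GaugeField P i G)
    {g : ℝ} (h : chiSmall S δ V * g ≠ 0) : PlaqSmallOn S δ V := by
  by_contra hV
  apply h
  unfold chiSmall
  rw [if_neg hV, zero_mul]

end Support

/-! ## §3 At the record: the piece of a sequence of NODE 00's T-step, with the averaging `avOfRecord` -/

section OfRecord

open Literature.MathematicalPhysics.QuantumFieldTheory.Balaban1983to89.Node00
open Literature.MathematicalPhysics.QuantumFieldTheory.Balaban1983to89.T4FiniteEpsInhabited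
open B14.Eq218Concrete
open Summit.QuantumFields.YangMills.BalabanUVNodes.N20LCSAtTStepOfRecord (lcs_piece_tstepOfRecord_of_carrier_le_on_support)

/-- The plaquette-energy carrier `V ↦ exp(t·Σ_{p′∈Q}(1 − Re tr V(∂p′)))` is measurable at every level. [folklore] -/
theorem measurable_exp_plaqSum_level {N : ℕ} [NeZero N] (P : Params) (i : ℕ) (t : ℝ) (Q : Finset (Plaq P i)) :
    Measurable fun V : GaugeField P i (Matrix.specialUnitaryGroup (Fin N) ℂ) =>
      Real.exp (t * ∑ p ∈ Q, (1 - reTr (GaugeField.plaqHol V p))) :=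
  Real.measurable_exp.comp ((Finset.measurable_sum Q fun p _ =>
    measurable_const.sub (RegularGaugeGroup.measurable_reTr.comp (Missing.measurable_plaqHol p))).const_mul t)

/-- The carrier is bounded at every level: `|exp(t·Σ_{p′∈Q}(1 − Re tr V(∂p′)))| ≤ exp(|t|·2·#Q)`. [folklore] -/
theorem abs_exp_plaqSum_level_le {N : ℕ} [NeZero N] (P : Params) (i : ℕ) (t : ℝ) (Q : Finset (Plaq P i))
    (V : GaugeField P i (Matrix.specialUnitaryGroup (Fin N) ℂ)) :
    |Real.exp (t * ∑ p ∈ Q, (1 - reTr (GaugeField.plaqHol V p)))| ≤ Real.exp (|t| * (2 * Q.card)) := by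
  rw [Real.abs_exp]
  refine Real.exp_le_exp.2 ((le_abs_self _).trans ?_)
  rw [abs_mul]
  refine mul_le_mul_of_nonneg_left ?_ (abs_nonneg t)
  have h0 : ∀ p ∈ Q, 0 ≤ 1 - reTr (GaugeField.plaqHol V p) := fun p _ => (RegularGaugeGroup.one_sub_reTr_mem_Icc _).1
  rw [abs_of_nonneg (Finset.sum_nonneg h0)]
  calc ∑ p ∈ Q, (1 - reTr (GaugeField.plaqHol V p)) ≤ ∑ _p ∈ Q, (2 : ℝ) :=
        Finset.sum_le_sum fun p _ => (RegularGaugeGroup.one_sub_reTr_mem_Icc _).2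
    _ = 2 * Q.card := by rw [Finset.sum_const, nsmul_eq_mul]; ring

variable (F : T4Family) (N : ℕ) [NeZero N] (ν : Stage7Numerics) (Mν : ℕ) (w : StepWeightsOfRecord F N ν Mν)
  (p : B12.RunParams) (g : ℕ → ℝ) (k : ℕ)

/-- **«LCS-(k+1)» BY VALUE FOR THE EXPONENTIAL PLAQUETTE-ENERGY CARRIERS OF THE AVERAGED FIELD, AT THE RECORD.**  For NODE 00's T-step of
record at a performed level `k < K`, a new sequence `s′` of record with the displayed provisos of n20-c's module 3 (integrable old piece, bounded
jointly measurable step weight, measurable new front factor, non-negative pinned fine density), a finite set `Q` of level-`(k+1)` plaquettes,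
`t ≥ 0`, `0 ≤ δ` with `(((d+2)L)²/4)·δ < δ_N`, and the SMALLNESS-ON-SUPPORT hypothesis `hsupp` (wherever the pinned fine density is non-zero,
every level-`k` plaquette of the boxes `boxRegion (emb p′₋) ((d+3)L+2)`, `p′ ∈ Q`, is `δ`-close to `1`): the `LocCondStability` inequality of the piece
holds for `M = exp(t·Σ_{p′∈Q}(1 − reTr V(∂p′)))` with `b = t·(C_L δ)²·#Q` — `lcs_piece_tstepOfRecord_of_carrier_le_on_support` with its `hMb`
discharged by §1 (`Ū = (avOfRecord F N K k).avg U = avgFun expMeanLogSU U`). [cite: Balaban1989LargeFieldII, p.383; Balaban1987RG1, (0.4) p.253] -/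
theorem lcs_piece_tstepOfRecord_expPlaqSum_byValue (hk : k < p.K)
    (T : SeqOfRecord F ν Mν g p.K k → Density (F.P p.K) k (SU N)) (s' : SeqOfRecord F ν Mν g p.K (k + 1))
    (hT : Integrable (fun U => chiSeqOfRecord F N ν Mν g p.K k s'.init U * T s'.init U) (fieldMeasure (F.P p.K) k (SU N)))
    (hw : Measurable
      (fun z : GaugeField (F.P p.K) (k + 1) (SU N) × GaugeField (F.P p.K) k (SU N) => w p g k s' z.2 z.1))
    (hwb : ∀ U V', |w p g k s' U V'| ≤ 1) (hχ : Measurable (chiSeqOfRecord F N ν Mν g p.K (k + 1) s'))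
    (h0 : ∀ U, 0 ≤ (chiSeqOfRecord F N ν Mν g p.K (k + 1) s' ((avOfRecord F N p.K k).avg U) *
        w p g k s' U ((avOfRecord F N p.K k).avg U)) * (chiSeqOfRecord F N ν Mν g p.K k s'.init U * T s'.init U))
    (Q : Finset (Plaq (F.P p.K) (k + 1))) {t : ℝ} (ht0 : 0 ≤ t) {δ : ℝ} (hδ : 0 ≤ δ)
    (hguard : (((((F.P p.K).d + 2) * (F.P p.K).L : ℕ) : ℝ) ^ 2 / 4) * δ < deltaSU (Fin N))
    (hsupp : ∀ U, (chiSeqOfRecord F N ν Mν g p.K (k + 1) s' ((avOfRecord F N p.K k).avg U) *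
        w p g k s' U ((avOfRecord F N p.K k).avg U)) * (chiSeqOfRecord F N ν Mν g p.K k s'.init U * T s'.init U) ≠ 0 →
        ∀ p' ∈ Q, ∀ q ∈ boxRegion (emb p'.src) (((F.P p.K).d + 3) * (F.P p.K).L + 2), dist1 (GaugeField.plaqHol U q) ≤ δ) :
    ∫ V', Real.exp (t * ∑ p' ∈ Q, (1 - reTr (GaugeField.plaqHol V' p'))) *
          (chiSeqOfRecord F N ν Mν g p.K (k + 1) s' V' * tstepOfRecord F N ν Mν w p g k T s' V')
        ∂(fieldMeasure (F.P p.K) (k + 1) (SU N)) ≤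
      Real.exp (t * (((((F.P p.K).L : ℝ) ^ 2 + 6 * ((((F.P p.K).d + 2) * (F.P p.K).L : ℕ) : ℝ) ^ 2) * δ) ^ 2 * Q.card)) *
        ∫ V', chiSeqOfRecord F N ν Mν g p.K (k + 1) s' V' * tstepOfRecord F N ν Mν w p g k T s' V'
          ∂(fieldMeasure (F.P p.K) (k + 1) (SU N)) := by
  have hj : k + 1 ≤ (F.P p.K).m + (F.P p.K).K := by
    rw [T4Family.P_K, T4Family.P_m]; have := F.hm; omega
  refine lcs_piece_tstepOfRecord_of_carrier_le_on_support F N ν Mν w p g k hk T s' hT hw hwb hχ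
    (measurable_exp_plaqSum_level (F.P p.K) (k + 1) t Q) (fun V' => abs_exp_plaqSum_level_le (F.P p.K) (k + 1) t Q V') h0 fun U hU => ?_
  rw [avOfRecord_avg]
  exact exp_plaqSum_avgFun_le_of_small (n := Fin N) hj hδ hguard ht0 U Q (hsupp U hU)

end OfRecord

end Summit.QuantumFields.YangMills.BalabanUVNodes.N20LCSAvgByValue

end
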